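import Mathlib
import Literature.Geometry.Symplectic.SteinBall
import Summits.SmoothPoincare4.SmoothPoincare4.Theorems.HyperbolicEnd.Negative.ProductRule
import Summits.SmoothPoincare4.SmoothPoincare4.Theorems.HyperbolicEnd.Negative.ExpRule
import Summits.SmoothPoincare4.SmoothPoincare4.Theorems.HyperbolicEnd.Negative.NormSqDeriv
import Summits.SmoothPoincare4.SmoothPoincare4.Theorems.HyperbolicEnd.Negative.LaplacianComp
import Summits.SmoothPoincare4.SmoothPoincare4.Theorems.HyperbolicEnd.Negative.PsiContDiff
import Summits.SmoothPoincare4.SmoothPoincare4.Theorems.HyperbolicEnd.Negative.HessianBound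

/-!
# `HyperbolicEnd` (stmt-SmoothPoincare4-7825), line `Sketch`, negative side — the certified shell germ

Helper for the native frozen-`J` refutation of the flat certificate filling stub on
`ℝ⁴ = EuclideanSpace ℝ (Fin 4)` with `J` frozen to the standard complex structure
`J₀ = Literature.Geometry.Symplectic.stdComplexStructure` (tree dir
`Theorems/HyperbolicEnd/Negative/`). Statement registered on the crux item
(stub helper_frozen_shellWitness).

**The statement (hypothesis side of the refutation).** With `q₁ x = x 0 ^ 2 + x 1 ^ 2`,
`q₂ x = x 2 ^ 2 + x 3 ^ 2`, the cutoff `χ t = Real.smoothTransition ((81/100 - t) * (25/14))` and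
the potential `ψ_M x = -8 χ (q₂ x) log (q₁ x + 1/1000) + M q₂ x + (q₁ x + q₂ x)`, there are
`M ≥ 0` and `c > 0` such that the conformal density `F(x, v) = exp (2 ψ_M x) ‖v‖²` is a
certificate with constant `c` along every smooth `J₀`-holomorphic curve `g : U → ℝ⁴`
(`Dg(z)(I ζ) = J₀ (Dg(z) ζ)`) with values in the shell `1 < ‖x‖ < 4`: the function
`λ(w) = exp (2 ψ_M (g w)) ‖Dg(w) 1‖²` is `C²` on `U` and `2 c λ³ ≤ λ Δλ - |∇λ|²` there
(`|∇λ|² = (Dλ(z) 1)² + (Dλ(z) I)²`, `Δ` Mathlib's Laplacian on `ℂ = ℝ²`).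

**Proof.** Take the `M` of `helper_frozen_hessianBound` (`HessianBound.lean`): on the shell,
`D²ψ_M(x)[v, v] + D²ψ_M(x)[J₀ v, J₀ v] ≥ 2‖v‖²` and `ψ_M ≤ 30 + 16 M`; put
`c = 2 exp (-2 (30 + 16 M))`.  Write `λ = a · m` with `a = exp ∘ u`, `u = 2 ψ_M ∘ g`,
`m = ‖Dg 1‖²`.  Smoothness: `ψ_M` is smooth (`helper_frozen_psiContDiff`), so `u`, `a` are smooth
on `U`, and so is `m` (`helper_frozen_normSqDeriv`).  At `z ∈ U`, by the product rule
(`helper_frozen_productRule`) `λ Δλ - |∇λ|² = m² (a Δa - |∇a|²) + a² (m Δm - |∇m|²)`, where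
`m Δm - |∇m|² ≥ 0` (`helper_frozen_normSqDeriv`) and `a Δa - |∇a|² = a² Δu`
(`helper_frozen_expRule`).  By `helper_frozen_laplacianComp` and linearity of `Δ`,
`Δu(z) = 2 (D²ψ_M(g z)[v, v] + D²ψ_M(g z)[J₀ v, J₀ v]) ≥ 4 ‖v‖² = 4 m(z)` with `v = Dg(z) 1`.
Hence `λ Δλ - |∇λ|² ≥ 4 a² m³`, while `2 c λ³ = (c a) · 2 a² m³ ≤ 4 a² m³` because
`c a = 2 exp (2 ψ_M (g z) - 2 (30 + 16 M)) ≤ 2`.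
-/

noncomputable section

-- the prescribed namespace `Summit.<P>.<Sub>.…` duplicates `SmoothPoincare4` (P = Sub)
set_option linter.dupNamespace false

open scoped ContDiff Topology Real
open Laplacian Set Filter Metric Complex

namespace Summit.SmoothPoincare4.SmoothPoincare4.Theorems.HyperbolicEnd.Negative

/-! ### Pointwise algebra -/

/-- **The final estimate.** If `R = Mz² Xa + A² Xm` with `Xm ≥ 0`, `Xa = A² Du`, `Du ≥ 4 Mz`,
`Mz ≥ 0` and `c A ≤ 2`, then `2 c (A Mz)³ ≤ R`
(`2 c A³ Mz³ = (c A) (2 A² Mz³) ≤ 4 A² Mz³ ≤ Mz² A² Du ≤ R`). -/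
private theorem shellWitness_algebra {A Mz c R Xa Xm Du : ℝ} (hR : R = Mz ^ 2 * Xa + A ^ 2 * Xm)
    (hXm : 0 ≤ Xm) (hXa : Xa = A ^ 2 * Du) (hDu : 4 * Mz ≤ Du) (hMz : 0 ≤ Mz)
    (hcA : c * A ≤ 2) : 2 * c * (A * Mz) ^ 3 ≤ R := by
  rw [hR, hXa]
  have h1 : 0 ≤ A ^ 2 * Xm := mul_nonneg (sq_nonneg A) hXm
  have h2 : Mz ^ 2 * (A ^ 2 * (4 * Mz)) ≤ Mz ^ 2 * (A ^ 2 * Du) :=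
    mul_le_mul_of_nonneg_left (mul_le_mul_of_nonneg_left hDu (sq_nonneg A)) (sq_nonneg Mz)
  have h3 : 2 * c * (A * Mz) ^ 3 = (c * A) * (2 * A ^ 2 * Mz ^ 3) := by ring
  have h4 : (c * A) * (2 * A ^ 2 * Mz ^ 3) ≤ 2 * (2 * A ^ 2 * Mz ^ 3) :=
    mul_le_mul_of_nonneg_right hcA
      (mul_nonneg (mul_nonneg zero_le_two (sq_nonneg A)) (pow_nonneg hMz 3))
  have h5 : 2 * (2 * A ^ 2 * Mz ^ 3) = Mz ^ 2 * (A ^ 2 * (4 * Mz)) := by ring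
  linarith

/-- **The level bound gives `c a ≤ 2`.** If `P ≤ 30 + 16 M` then
`2 e^{-2 (30 + 16 M)} e^{2 P} ≤ 2`. -/
private theorem shellWitness_level {M P : ℝ} (hP : P ≤ 30 + 16 * M) :
    2 * Real.exp (-(2 * (30 + 16 * M))) * Real.exp (2 * P) ≤ 2 := by
  have hE : Real.exp (-(2 * (30 + 16 * M))) * Real.exp (2 * P) ≤ 1 := by
    rw [← Real.exp_add]
    exact Real.exp_le_one_iff.mpr (by linarith)
  linarith

/-! ### The certificate along a `J₀`-curve, for an abstract potential -/

/-- **Core.** Let `ψ : ℝ⁴ → ℝ` be smooth with `D²ψ(x)[v, v] + D²ψ(x)[J₀ v, J₀ v] ≥ 2‖v‖²` and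
`ψ x ≤ 30 + 16 M` for `x ∈ S`, and let `g` be a smooth `J₀`-holomorphic curve on the open set
`U` with values in `S`.  Then `λ(w) = exp (2 ψ (g w)) ‖Dg(w) 1‖²` is `C²` on `U` and
`2 c λ³ ≤ λ Δλ - |∇λ|²` on `U` with `c = 2 exp (-2 (30 + 16 M))`. -/
private theorem shellWitness_core {ψ : EuclideanSpace ℝ (Fin 4) → ℝ} {M : ℝ}
    {S : Set (EuclideanSpace ℝ (Fin 4))} (hψ : ContDiff ℝ ∞ ψ)
    (hHess : ∀ x ∈ S, ∀ v : EuclideanSpace ℝ (Fin 4), 2 * ‖v‖ ^ 2 ≤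
      iteratedFDeriv ℝ 2 ψ x ![v, v] + iteratedFDeriv ℝ 2 ψ x
        ![Literature.Geometry.Symplectic.stdComplexStructure v,
          Literature.Geometry.Symplectic.stdComplexStructure v])
    (hSup : ∀ x ∈ S, ψ x ≤ 30 + 16 * M) {U : Set ℂ} {g : ℂ → EuclideanSpace ℝ (Fin 4)}
    (hU : IsOpen U) (hg : ContDiffOn ℝ ∞ g U)
    (hhol : ∀ z ∈ U, ∀ ζ : ℂ, fderiv ℝ g z (Complex.I * ζ) =
      Literature.Geometry.Symplectic.stdComplexStructure (fderiv ℝ g z ζ))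
    (hmem : ∀ z ∈ U, g z ∈ S) :
    ContDiffOn ℝ 2 (fun w => Real.exp (2 * ψ (g w)) * ‖fderiv ℝ g w 1‖ ^ 2) U ∧
      ∀ z ∈ U, 2 * (2 * Real.exp (-(2 * (30 + 16 * M)))) *
          (Real.exp (2 * ψ (g z)) * ‖fderiv ℝ g z 1‖ ^ 2) ^ 3 ≤
        Real.exp (2 * ψ (g z)) * ‖fderiv ℝ g z 1‖ ^ 2 *
            (Δ (fun w => Real.exp (2 * ψ (g w)) * ‖fderiv ℝ g w 1‖ ^ 2)) z -
          ((fderiv ℝ (fun w => Real.exp (2 * ψ (g w)) * ‖fderiv ℝ g w 1‖ ^ 2) z 1) ^ 2 +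
            (fderiv ℝ (fun w => Real.exp (2 * ψ (g w)) * ‖fderiv ℝ g w 1‖ ^ 2) z
              Complex.I) ^ 2) := by
  have h2top : (2 : WithTop ℕ∞) ≤ ∞ := WithTop.coe_le_coe.2 le_top
  -- the speed `m = ‖Dg 1‖²` is smooth with `m Δm - |∇m|² ≥ 0`
  obtain ⟨hm, hXm⟩ := helper_frozen_normSqDeriv U g hU hg hhol
  -- the exponent `u = 2 ψ ∘ g` and the conformal factor `a = exp ∘ u` are smooth on `U`
  have hu : ContDiffOn ℝ ∞ (fun w => 2 * ψ (g w)) U :=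
    contDiffOn_const.mul (hψ.comp_contDiffOn hg)
  have ha : ContDiffOn ℝ ∞ (fun w => Real.exp (2 * ψ (g w))) U := hu.exp
  refine ⟨(ha.mul hm).of_le h2top, fun z hz => ?_⟩
  have hzU : U ∈ 𝓝 z := hU.mem_nhds hz
  have hu2 : ContDiffAt ℝ 2 (fun w => 2 * ψ (g w)) z := ((hu z hz).contDiffAt hzU).of_le h2top
  have ha2 : ContDiffAt ℝ 2 (fun w => Real.exp (2 * ψ (g w))) z :=
    ((ha z hz).contDiffAt hzU).of_le h2top
  have hm2 : ContDiffAt ℝ 2 (fun w => ‖fderiv ℝ g w 1‖ ^ 2) z :=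
    ((hm z hz).contDiffAt hzU).of_le h2top
  have hg2 : ContDiffAt ℝ 2 g z := ((hg z hz).contDiffAt hzU).of_le h2top
  have hψ2 : ContDiff ℝ 2 ψ := hψ.of_le h2top
  -- (T1) the product rule for `λ = a · m`
  have hP := helper_frozen_productRule (fun w => Real.exp (2 * ψ (g w)))
    (fun w => ‖fderiv ℝ g w 1‖ ^ 2) z ha2 hm2
  -- (T2) the exponential rule for `a = exp ∘ u`
  have hE := helper_frozen_expRule (fun w => 2 * ψ (g w)) z hu2
  -- (T4) the Laplacian of `ψ ∘ g`, and `Δu = 2 Δ(ψ ∘ g) ≥ 4 m`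
  have hL := helper_frozen_laplacianComp ψ U g z hU hz hψ2 hg hhol
  have hψg : ContDiffAt ℝ 2 (fun w => ψ (g w)) z := hψ2.contDiffAt.comp z hg2
  have hDu : 4 * ‖fderiv ℝ g z 1‖ ^ 2 ≤ (Δ (fun w => 2 * ψ (g w))) z := by
    show 4 * ‖fderiv ℝ g z 1‖ ^ 2 ≤ (Δ ((2 : ℝ) • fun w => ψ (g w))) z
    rw [InnerProductSpace.laplacian_smul (2 : ℝ) hψg, smul_eq_mul, hL]
    have hH := hHess (g z) (hmem z hz) (fderiv ℝ g z 1)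
    linarith
  -- the level bound: `c a ≤ 2`
  have hcA := shellWitness_level (hSup (g z) (hmem z hz))
  beta_reduce at hP hE
  exact shellWitness_algebra hP (hXm z hz) hE hDu (sq_nonneg _) hcA

/-! ### The helper -/

/-- helper (D1): **the certified shell germ.** For the `M ≥ 0` of `helper_frozen_hessianBound`
and `c = 2 exp (-2 (30 + 16 M)) > 0`, the conformal density `F(x, v) = exp (2 ψ_M x) ‖v‖²` is a
flat certificate with constant `c` along every smooth `J₀`-holomorphic curve `g` on an open
`U ⊆ ℂ` with values in the shell `1 < ‖x‖ < 4`: `λ = F(g, Dg 1)` is `C²` on `U` and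
`2 c λ³ ≤ λ Δλ - |∇λ|²` there. -/
theorem helper_frozen_shellWitness : ∃ (M c : ℝ), 0 ≤ M ∧ 0 < c ∧ ∀ (U : Set ℂ) (g : ℂ → EuclideanSpace ℝ (Fin 4)), IsOpen U → ContDiffOn ℝ ∞ g U → (∀ z ∈ U, ∀ ζ : ℂ, fderiv ℝ g z (Complex.I * ζ) = Literature.Geometry.Symplectic.stdComplexStructure (fderiv ℝ g z ζ)) → (∀ z ∈ U, g z ∈ Metric.ball (0 : EuclideanSpace ℝ (Fin 4)) 4 \ Metric.closedBall (0 : EuclideanSpace ℝ (Fin 4)) 1) → ContDiffOn ℝ 2 (fun w => Real.exp (2 * (-8 * Real.smoothTransition ((81 / 100 - ((g w) 2 ^ 2 + (g w) 3 ^ 2)) * (25 / 14)) * Real.log ((g w) 0 ^ 2 + (g w) 1 ^ 2 + 1 / 1000) + M * ((g w) 2 ^ 2 + (g w) 3 ^ 2) + ((g w) 0 ^ 2 + (g w) 1 ^ 2 + (g w) 2 ^ 2 + (g w) 3 ^ 2))) * ‖fderiv ℝ g w 1‖ ^ 2) U ∧ ∀ z ∈ U, 2 * c * (Real.exp (2 *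 (-8 * Real.smoothTransition ((81 / 100 - ((g z) 2 ^ 2 + (g z) 3 ^ 2)) * (25 / 14)) * Real.log ((g z) 0 ^ 2 + (g z) 1 ^ 2 + 1 / 1000) + M * ((g z) 2 ^ 2 + (g z) 3 ^ 2) + ((g z) 0 ^ 2 + (g z) 1 ^ 2 + (g z) 2 ^ 2 + (g z) 3 ^ 2))) * ‖fderiv ℝ g z 1‖ ^ 2) ^ 3 ≤ Real.exp (2 * (-8 * Real.smoothTransition ((81 / 100 - ((g z) 2 ^ 2 + (g z) 3 ^ 2)) * (25 / 14)) * Real.log ((g z) 0 ^ 2 + (g z) 1 ^ 2 + 1 / 1000) + M * ((g z) 2 ^ 2 + (g z) 3 ^ 2) + ((g z) 0 ^ 2 + (g z) 1 ^ 2 + (g z) 2 ^ 2 + (g z) 3 ^ 2))) * ‖fderiv ℝ g z 1‖ ^ 2 * (Δ (fun w => Real.exp (2 * (-8 * Real.smoothTransition ((81 / 100 - ((g w) 2 ^ 2 + (g w) 3 ^ 2)) * (25 / 14)) * Real.log ((g w) 0 ^ 2 + (g w) 1 ^ 2 + 1 / 1000) + M * ((g w) 2 ^ 2 + (g w) 3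 ^ 2) + ((g w) 0 ^ 2 + (g w) 1 ^ 2 + (g w) 2 ^ 2 + (g w) 3 ^ 2))) * ‖fderiv ℝ g w 1‖ ^ 2)) z - ((fderiv ℝ (fun w => Real.exp (2 * (-8 * Real.smoothTransition ((81 / 100 - ((g w) 2 ^ 2 + (g w) 3 ^ 2)) * (25 / 14)) * Real.log ((g w) 0 ^ 2 + (g w) 1 ^ 2 + 1 / 1000) + M * ((g w) 2 ^ 2 + (g w) 3 ^ 2) + ((g w) 0 ^ 2 + (g w) 1 ^ 2 + (g w) 2 ^ 2 + (g w) 3 ^ 2))) * ‖fderiv ℝ g w 1‖ ^ 2) z 1) ^ 2 + (fderiv ℝ (fun w => Real.exp (2 * (-8 * Real.smoothTransition ((81 / 100 - ((g w) 2 ^ 2 + (g w) 3 ^ 2)) * (25 / 14)) * Real.log ((g w) 0 ^ 2 + (g w) 1 ^ 2 + 1 / 1000) + M * ((g w) 2 ^ 2 + (g w) 3 ^ 2) + ((g w) 0 ^ 2 + (g w) 1 ^ 2 + (g w) 2 ^ 2 + (g w) 3 ^ 2))) * ‖fderiv ℝ g w 1‖ ^ 2) z Complex.I) ^ 2) :=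 by
  obtain ⟨M, hM, hHess, hSup⟩ := helper_frozen_hessianBound
  refine ⟨M, 2 * Real.exp (-(2 * (30 + 16 * M))), hM, by positivity, ?_⟩
  intro U g hU hg hhol hmem
  have key := shellWitness_core (helper_frozen_psiContDiff M) hHess hSup hU hg hhol hmem
  exact key

end Summit.SmoothPoincare4.SmoothPoincare4.Theorems.HyperbolicEnd.Negative

end
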